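import Literature.MathematicalPhysics.QuantumFieldTheory.ConformalBootstrap3D.BlockCoefficientExtraction
import Literature.MathematicalPhysics.QuantumFieldTheory.ConformalBootstrap3D.SingleCorrelatorCertificate
import Mathlib.Topology.Algebra.InfiniteSum.Real
import HarnessLib

/-!
# The Hogervorst–Rychkov `z`-series of a genuine block at every REAL point of the square

`BlockDiagonalEnclosure.lean` identifies a genuine block (the typed predicate
`IsConformalBlock3D 0 0 Δ ℓ g` of `SigmaEpsilonSystem.lean`) on the DIAGONAL `z = z̄`. Point-evaluation
functionals with OFF-diagonal real nodes `(z_k, z̄_k) ∈ (0,1)²` (the class whose termwise action is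
proved, `DualFunctional.pointFunctional`) need the block at every real point of the square. This file
proves, at every regular `(Δ, ℓ)` (strictly above the unitarity bound, no accidental degeneracy) and
every `0 < x, y < 1`,

  `g(x, y) = λ_ℓ⁻¹ Σ_{n, j} A_{n,j}(Δ, ℓ) · (xy)^{(Δ+n-j)/2} · 𝒫_j(x, y)`,
  `𝒫_j(x, y) := Σ_{i+r=j} λ_i λ_r x^i y^r`  (`λ_i = C(2i,i)/4^i`),

as an (absolutely) convergent double series with NON-NEGATIVE terms (`IsConformalBlock3D.hasSum_hrZTerm`),
where `A_{n,j} = hrCoeff Δ ℓ n j ≥ 0` are the `z`-series coefficients of Hogervorst–Rychkov 2013,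
eq. (3.9) (`ZSeriesBlockCoefficients.lean`). Here `(xy)^{(E-j)/2} 𝒫_j(x,y)` is the function
`𝒫_{E,j}(s, ξ) = s^E P_j(ξ)` of HR eq. (3.6) (`d = 3`: `j!/(2ν)_j C^ν_j = P_j`, Legendre) written at a real
point, `s = √(xy)`, `ξ = (x+y)/(2√(xy)) ≥ 1`, through `s^j P_j(ξ) = Σ_{i+r=j} λ_i λ_r x^i y^r`
(`P_j(cos θ) = Σ_{i+r=j} λ_i λ_r e^{i(i-r)θ}` continued to `e^{iθ} = √(x/y)`); on the diagonal
`𝒫_j(x, x) = x^j` (`zLegendre_diag`, `P_j(1) = 1`).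

Proof: at a regular point the block is `(z z̄)^{(Δ-ℓ)/2} Σ k_{mn} z^m z̄^n` with `k = hrMonomialCoeff Δ ℓ`
(T1: `IsConformalBlock3DAbove.exists_coeff` + `SatisfiesCoeffCasimir.eq_hrMonomialCoeff`); sum the
absolutely convergent double power series along antidiagonals `m + n = N`; on each antidiagonal
`k` is the finite combination `Σ_j (A_{N-ℓ,j}/λ_ℓ) e_{N,j}` of Legendre arrays whose monomial sums are
`(xy)^{(N-j)/2} 𝒫_j(x,y)` (`sum_antidiagonal_legendreArrDeg_mul_pow`); regroup the non-negative terms over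
`(N, j) ∈ ℕ × ℕ` (`summable_prod_of_nonneg`) and shift `N = ℓ + n`.

Consequences for certificates with real point functionals `φ = Σ_k w_k ev_{(z_k, z̄_k)}`:
`φ[F^{σσ,σσ}_{-,Δ,ℓ}[g]] = Σ_{n,j} (A_{n,j}/λ_ℓ) φ[F_-[𝒫_{Δ+n,j}]]` (`hasSum_pointFunctional_crossF_hrZ`), hence
BLOCK POSITIVITY FROM TERMWISE POSITIVITY: if `φ[F_-[𝒫_{Δ+n,j}]] ≥ 0` for every `(n, j)` on the
descendant range outside a finite set `F` and the finite head `Σ_{(n,j) ∈ F} (A_{n,j}/λ_ℓ) φ[F_-[𝒫_{Δ+n,j}]]`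
is `≥ 0`, then `BlockPositive φ s Δ ℓ` (`blockPositive_pointFunctional_of_termwise`; `F = ∅`:
`blockPositive_pointFunctional_of_forall`). Non-regular points (`Δ = ℓ+1`, accidental degeneracies) are
reached from the right by `BoundaryCellPositivity.blockPositive_of_eventually_right`.

What this file does NOT contain: any bound comparing `𝒫_{E,j}` at two points (the Legendre growth
comparison used for the tail `Δ ≥ Δ⋆`), any value of `A_{n,j}`, anything at non-regular `(Δ, ℓ)` or for
unequal external dimensions.

Sources: M. Hogervorst, S. Rychkov, *Radial coordinates for conformal blocks*, Phys. Rev. D 87 (2013)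
106004, arXiv:1303.1111, §3 eqs. (3.4)–(3.6), (3.9); F. A. Dolan, H. Osborn, Nucl. Phys. B 599 (2001)
459, arXiv:hep-th/0011040, §2 eqs. (2.9)–(2.12), (2.19). Mathlib: `summable_prod_of_nonneg`,
`HasSum.prod_fiberwise`, `Function.Injective.hasSum_iff`, `Finset.sum_image`, `Finset.sum_subset`.
-/

namespace Literature.MathematicalPhysics.QuantumFieldTheory.ConformalBootstrap3D

open Finset Set

/-! ### The Legendre form `𝒫_j(x, y) = s^j P_j(ξ)` at a real point -/

/-- `𝒫_j(x,y) := Σ_{i+r=j} λ_i λ_r x^i y^r` — the value of `s^j P_j(ξ)`, `s = √(xy)`,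
`ξ = (x+y)/(2s)`, at a real point (from `P_j(cos θ) = Σ_{i+r=j} λ_i λ_r e^{i(i-r)θ}`).
[cite: HogervorstRychkov2013, §3 eq. (3.6)] -/
noncomputable def zLegendre (j : ℕ) (x y : ℝ) : ℝ :=
  ∑ c ∈ antidiagonal j, legendreLam c.1 * legendreLam c.2 * x ^ c.1 * y ^ c.2

/-- `𝒫_j(x,y) ≥ 0` for `x, y ≥ 0`. [folklore] -/
theorem zLegendre_nonneg (j : ℕ) {x y : ℝ} (hx : 0 ≤ x) (hy : 0 ≤ y) : 0 ≤ zLegendre j x y :=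
  sum_nonneg fun c _ => by
    have := legendreLam_pos c.1
    have := legendreLam_pos c.2
    positivity

/-- `𝒫_j` is symmetric. [folklore] -/
theorem zLegendre_symm (j : ℕ) (x y : ℝ) : zLegendre j y x = zLegendre j x y := by
  unfold zLegendre
  rw [← Nat.sum_antidiagonal_swap]
  exact sum_congr rfl fun c _ => by simp only [Prod.fst_swap, Prod.snd_swap]; ring

/-- On the diagonal `𝒫_j(x,x) = x^j` (`P_j(1) = Σ_{i+r=j} λ_i λ_r = 1`). [folklore] -/
theorem zLegendre_diag (j : ℕ) (x : ℝ) : zLegendre j x x = x ^ j := by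
  unfold zLegendre
  calc ∑ c ∈ antidiagonal j, legendreLam c.1 * legendreLam c.2 * x ^ c.1 * x ^ c.2
      = ∑ c ∈ antidiagonal j, legendreLam c.1 * legendreLam c.2 * x ^ j :=
        sum_congr rfl fun c hc => by
          rw [mem_antidiagonal] at hc
          rw [mul_assoc, ← pow_add, hc]
    _ = x ^ j := by rw [← sum_mul, sum_antidiagonal_legendreLam_mul, one_mul]

/-- `𝒫_j(x,y) ≤ M^j` for `0 ≤ x, y ≤ M`. [folklore] -/
theorem zLegendre_le_pow (j : ℕ) {x y M : ℝ} (hx : 0 ≤ x) (hy : 0 ≤ y) (hxM : x ≤ M) (hyM : y ≤ M) :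
    zLegendre j x y ≤ M ^ j := by
  unfold zLegendre
  calc ∑ c ∈ antidiagonal j, legendreLam c.1 * legendreLam c.2 * x ^ c.1 * y ^ c.2
      ≤ ∑ c ∈ antidiagonal j, legendreLam c.1 * legendreLam c.2 * M ^ j := by
        refine sum_le_sum fun c hc => ?_
        rw [mem_antidiagonal] at hc
        have h1 : x ^ c.1 * y ^ c.2 ≤ M ^ c.1 * M ^ c.2 :=
          mul_le_mul (pow_le_pow_left₀ hx hxM _) (pow_le_pow_left₀ hy hyM _) (pow_nonneg hy _)
            (pow_nonneg (hx.trans hxM) _)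
        rw [← pow_add, hc] at h1
        have h2 : 0 ≤ legendreLam c.1 * legendreLam c.2 :=
          mul_nonneg (legendreLam_pos _).le (legendreLam_pos _).le
        calc legendreLam c.1 * legendreLam c.2 * x ^ c.1 * y ^ c.2
            = legendreLam c.1 * legendreLam c.2 * (x ^ c.1 * y ^ c.2) := by ring
          _ ≤ legendreLam c.1 * legendreLam c.2 * M ^ j := mul_le_mul_of_nonneg_left h1 h2
    _ = M ^ j := by rw [← sum_mul, sum_antidiagonal_legendreLam_mul, one_mul]

/-- `𝒫_{E,j}(x,y) := (xy)^{(E-j)/2} 𝒫_j(x,y)` — the value of `s^E P_j(ξ)` at a real point of the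
square. [cite: HogervorstRychkov2013, §3 eq. (3.6)] -/
noncomputable def zMono (E : ℝ) (j : ℕ) (x y : ℝ) : ℝ :=
  (x * y) ^ ((E - (j : ℝ)) / 2) * zLegendre j x y

/-- `𝒫_{E,j}(x,y) ≥ 0` for `x, y ≥ 0`. [folklore] -/
theorem zMono_nonneg (E : ℝ) (j : ℕ) {x y : ℝ} (hx : 0 ≤ x) (hy : 0 ≤ y) : 0 ≤ zMono E j x y :=
  mul_nonneg (Real.rpow_nonneg (mul_nonneg hx hy) _) (zLegendre_nonneg j hx hy)

/-- `𝒫_{E,j}` is symmetric. [folklore] -/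
theorem zMono_symm (E : ℝ) (j : ℕ) (x y : ℝ) : zMono E j y x = zMono E j x y := by
  unfold zMono
  rw [mul_comm y x, zLegendre_symm]

/-- On the diagonal `𝒫_{E,j}(x,x) = x^E` (`0 < x`). [folklore] -/
theorem zMono_diag (E : ℝ) (j : ℕ) {x : ℝ} (hx : 0 < x) : zMono E j x x = x ^ E := by
  unfold zMono
  rw [zLegendre_diag, ← Real.rpow_natCast x j, show x * x = x ^ (2 : ℝ) by
    rw [Real.rpow_two, sq], ← Real.rpow_mul hx.le, ← Real.rpow_add hx]
  congr 1
  ring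

/-! ### Monomial sums of the Legendre arrays -/

/-- `Σ_{m+n = 2t+j} e_{t,j}(m,n) x^m y^n = (xy)^t 𝒫_j(x,y)`. [folklore] -/
theorem sum_antidiagonal_legendreArr_mul_pow (t j : ℕ) (x y : ℝ) :
    ∑ p ∈ antidiagonal (2 * t + j), legendreArr t j p * x ^ p.1 * y ^ p.2 =
      (x * y) ^ t * zLegendre j x y := by
  classical
  have hinj : Set.InjOn (fun c : ℕ × ℕ => (t + c.1, t + c.2)) ↑(antidiagonal j) := by
    intro a _ b _ h
    simp only [Prod.mk.injEq, add_right_inj] at h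
    exact Prod.ext h.1 h.2
  have hsub : (antidiagonal j).image (fun c : ℕ × ℕ => (t + c.1, t + c.2)) ⊆
      antidiagonal (2 * t + j) := by
    intro p hp
    rw [Finset.mem_image] at hp
    obtain ⟨c, hc, rfl⟩ := hp
    rw [mem_antidiagonal] at hc ⊢
    simp only
    omega
  have hzero : ∀ p ∈ antidiagonal (2 * t + j),
      p ∉ (antidiagonal j).image (fun c : ℕ × ℕ => (t + c.1, t + c.2)) →
        legendreArr t j p * x ^ p.1 * y ^ p.2 = 0 := by
    intro p hp hnot
    rw [mem_antidiagonal] at hp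
    obtain ⟨m, n⟩ := p
    simp only at hp
    have h0 : legendreArr t j (m, n) = 0 := by
      apply legendreArr_pair_eq_zero
      by_cases hm : t ≤ m
      · by_cases hn : t ≤ n
        · exact absurd (Finset.mem_image.mpr ⟨(m - t, n - t), by rw [mem_antidiagonal]; omega,
            Prod.ext (by simp only; omega) (by simp only; omega)⟩) hnot
        · exact Or.inr (Or.inl (by omega))
      · exact Or.inl (by omega)
    rw [h0, zero_mul, zero_mul]
  rw [← sum_subset hsub hzero, sum_image hinj]
  unfold zLegendre
  rw [mul_sum]
  refine sum_congr rfl fun c hc => ?_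
  rw [mem_antidiagonal] at hc
  simp only
  rw [legendreArr_pair t j (t + c.1) (t + c.2) c.1 c.2 rfl rfl hc]
  ring

/-- `Σ_{m+n=N} e_{N,j}(m,n) x^m y^n = (xy)^{(N-j)/2} 𝒫_j(x,y)` for `j ≤ N`, `j ≡ N (mod 2)`, else `0`.
[folklore] -/
theorem sum_antidiagonal_legendreArrDeg_mul_pow (N j : ℕ) (x y : ℝ) :
    ∑ p ∈ antidiagonal N, legendreArrDeg N j p * x ^ p.1 * y ^ p.2 =
      if j ≤ N ∧ (N + j) % 2 = 0 then (x * y) ^ ((N - j) / 2) * zLegendre j x y else 0 := by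
  by_cases hc : j ≤ N ∧ (N + j) % 2 = 0
  · simp only [legendreArrDeg, if_pos hc]
    have hN : 2 * ((N - j) / 2) + j = N := by omega
    have h := sum_antidiagonal_legendreArr_mul_pow ((N - j) / 2) j x y
    rwa [hN] at h
  · simp only [legendreArrDeg, if_neg hc, Pi.zero_apply, zero_mul, sum_const_zero]

/-- **The antidiagonal sums of the HR array**: for `N ≥ ℓ`,
`Σ_{m+n=N} k_{mn} x^m y^n = Σ_{j ≤ N} (A_{N-ℓ,j}/λ_ℓ) (xy)^{(N-j)/2} 𝒫_j(x,y)` (terms with the wrong parity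
vanish because `A_{N-ℓ,j}` does). [cite: HogervorstRychkov2013, §3 eqs. (3.4)–(3.6)] -/
theorem sum_antidiagonal_hrMonomialCoeff (Δ : ℝ) {ℓ N : ℕ} (hN : ℓ ≤ N) (x y : ℝ) :
    ∑ p ∈ antidiagonal N, hrMonomialCoeff Δ ℓ p * x ^ p.1 * y ^ p.2 =
      ∑ j ∈ range (N + 1), hrCoeff Δ ℓ (N - ℓ) j / legendreLam ℓ *
        ((x * y) ^ ((N - j) / 2) * zLegendre j x y) := by
  calc ∑ p ∈ antidiagonal N, hrMonomialCoeff Δ ℓ p * x ^ p.1 * y ^ p.2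
      = ∑ p ∈ antidiagonal N, ∑ j ∈ range (N + 1),
          hrCoeff Δ ℓ (N - ℓ) j / legendreLam ℓ * (legendreArrDeg N j p * x ^ p.1 * y ^ p.2) := by
        refine sum_congr rfl fun p hp => ?_
        rw [mem_antidiagonal] at hp
        rw [hrMonomialCoeff_eq_slice Δ ℓ hp hN]
        unfold hrSlice
        rw [sum_mul, sum_mul]
        exact sum_congr rfl fun j _ => by ring
    _ = ∑ j ∈ range (N + 1), hrCoeff Δ ℓ (N - ℓ) j / legendreLam ℓ *
          ∑ p ∈ antidiagonal N, legendreArrDeg N j p * x ^ p.1 * y ^ p.2 := by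
        rw [sum_comm]
        exact sum_congr rfl fun j _ => by rw [mul_sum]
    _ = _ := by
        refine sum_congr rfl fun j hj => ?_
        rw [sum_antidiagonal_legendreArrDeg_mul_pow]
        split_ifs with hc
        · rfl
        · have hzero : hrCoeff Δ ℓ (N - ℓ) j = 0 := by
            apply hrCoeff_eq_zero_of_not_inDescendantRange
            intro hr
            apply hc
            have hjN : j < N + 1 := Finset.mem_range.mp hj
            unfold InDescendantRange at hr
            omega
          rw [hzero, zero_div, zero_mul, zero_mul]

/-! ### Regrouping non-negative rows into a double series -/

/-- If `T ≥ 0` on `ℕ × ℕ` vanishes above the diagonal (`T(N,j) = 0` for `j > N`) and its finite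
row sums `Σ_{j ≤ N} T(N,j)` have sum `S`, then `T` has sum `S` as a double series. [folklore] -/
theorem hasSum_prod_of_hasSum_rows {T : ℕ × ℕ → ℝ} (hT : ∀ q, 0 ≤ T q)
    (hzero : ∀ N j : ℕ, N < j → T (N, j) = 0) {S : ℝ}
    (h : HasSum (fun N => ∑ j ∈ range (N + 1), T (N, j)) S) : HasSum T S := by
  have hrow : ∀ N, HasSum (fun j => T (N, j)) (∑ j ∈ range (N + 1), T (N, j)) := fun N =>
    hasSum_sum_of_ne_finset_zero fun j hj => hzero N j (by
      rw [Finset.mem_range, not_lt] at hj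
      omega)
  have hsum : Summable T := by
    refine (summable_prod_of_nonneg fun q => hT q).mpr ⟨fun N => (hrow N).summable, ?_⟩
    have hf : (fun N => ∑' j, T (N, j)) = fun N => ∑ j ∈ range (N + 1), T (N, j) :=
      funext fun N => (hrow N).tsum_eq
    rw [hf]
    exact h.summable
  have h2 : HasSum (fun N => ∑ j ∈ range (N + 1), T (N, j)) (∑' q, T q) :=
    hsum.hasSum.prod_fiberwise hrow
  rw [← h2.unique h]
  exact hsum.hasSum

/-! ### The `z`-series terms and the identification -/

/-- The `(n, j)` term of the `z`-series of the Dolan–Osborn-normalised block at a real point: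
`(A_{n,j}(Δ,ℓ)/λ_ℓ) 𝒫_{Δ+n,j}(x,y)`. [cite: HogervorstRychkov2013, §3 eqs. (3.4), (3.9)] -/
noncomputable def hrZTerm (Δ : ℝ) (ℓ : ℕ) (x y : ℝ) (q : ℕ × ℕ) : ℝ :=
  hrCoeff Δ ℓ q.1 q.2 / legendreLam ℓ * zMono (Δ + (q.1 : ℝ)) q.2 x y

/-- The terms are non-negative above the unitarity bound (`A_{n,j} ≥ 0`, `λ_ℓ > 0`,
`𝒫_{E,j}(x,y) ≥ 0`). [cite: HogervorstRychkov2013, §3 after eq. (3.9)] -/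
theorem hrZTerm_nonneg {Δ : ℝ} {ℓ : ℕ} (hΔ : unitarityBound3D ℓ < Δ) {x y : ℝ} (hx : 0 ≤ x)
    (hy : 0 ≤ y) (q : ℕ × ℕ) : 0 ≤ hrZTerm Δ ℓ x y q :=
  mul_nonneg (div_nonneg (hrCoeff_nonneg hΔ _ _) (legendreLam_pos ℓ).le) (zMono_nonneg _ _ hx hy)

/-- Degree-indexed terms `T(N, j) := (xy)^{(Δ-ℓ)/2} (A_{N-ℓ,j}/λ_ℓ) (xy)^{(N-j)/2} 𝒫_j(x,y)` for `N ≥ ℓ`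
(else `0`) — the row form used in the regrouping. [folklore] -/
noncomputable def hrZTermDeg (Δ : ℝ) (ℓ : ℕ) (x y : ℝ) (q : ℕ × ℕ) : ℝ :=
  if ℓ ≤ q.1 then (x * y) ^ ((Δ - (ℓ : ℝ)) / 2) *
    (hrCoeff Δ ℓ (q.1 - ℓ) q.2 / legendreLam ℓ * ((x * y) ^ ((q.1 - q.2) / 2) * zLegendre q.2 x y))
  else 0

/-- `T(N, j) ≥ 0` above the unitarity bound, `x, y ≥ 0`. [folklore] -/
theorem hrZTermDeg_nonneg {Δ : ℝ} {ℓ : ℕ} (hΔ : unitarityBound3D ℓ < Δ) {x y : ℝ} (hx : 0 ≤ x)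
    (hy : 0 ≤ y) (q : ℕ × ℕ) : 0 ≤ hrZTermDeg Δ ℓ x y q := by
  unfold hrZTermDeg
  split_ifs
  · refine mul_nonneg (Real.rpow_nonneg (mul_nonneg hx hy) _) (mul_nonneg ?_ ?_)
    · exact div_nonneg (hrCoeff_nonneg hΔ _ _) (legendreLam_pos ℓ).le
    · exact mul_nonneg (pow_nonneg (mul_nonneg hx hy) _) (zLegendre_nonneg _ hx hy)
  · exact le_rfl

/-- `T(N, j) = 0` for `j > N` (`A_{n,j} = 0` for `j > ℓ + n`). [folklore] -/
theorem hrZTermDeg_eq_zero_of_lt (Δ : ℝ) (ℓ : ℕ) (x y : ℝ) {N j : ℕ} (h : N < j) :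
    hrZTermDeg Δ ℓ x y (N, j) = 0 := by
  unfold hrZTermDeg
  split_ifs with hN
  · simp only
    rw [hrCoeff_eq_zero_of_lt Δ (show ℓ + (N - ℓ) < j by omega), zero_div, zero_mul, mul_zero]
  · rfl

/-- Row sums of `T`: `Σ_{j ≤ N} T(N,j) = (xy)^{(Δ-ℓ)/2} Σ_{m+n=N} k_{mn} x^m y^n` with `k` the HR array.
[cite: HogervorstRychkov2013, §3 eqs. (3.4)–(3.6)] -/
theorem sum_range_hrZTermDeg (Δ : ℝ) (ℓ : ℕ) (x y : ℝ) (N : ℕ) :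
    ∑ j ∈ range (N + 1), hrZTermDeg Δ ℓ x y (N, j) =
      (x * y) ^ ((Δ - (ℓ : ℝ)) / 2) *
        ∑ p ∈ antidiagonal N, hrMonomialCoeff Δ ℓ p * x ^ p.1 * y ^ p.2 := by
  by_cases hN : ℓ ≤ N
  · rw [sum_antidiagonal_hrMonomialCoeff Δ hN, mul_sum]
    exact sum_congr rfl fun j _ => by unfold hrZTermDeg; rw [if_pos hN]
  · rw [not_le] at hN
    have h1 : ∑ j ∈ range (N + 1), hrZTermDeg Δ ℓ x y (N, j) = 0 :=
      sum_eq_zero fun j _ => by unfold hrZTermDeg; rw [if_neg (by simp only; omega)]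
    have h2 : ∑ p ∈ antidiagonal N, hrMonomialCoeff Δ ℓ p * x ^ p.1 * y ^ p.2 = 0 :=
      sum_eq_zero fun p hp => by
        rw [mem_antidiagonal] at hp
        rw [hrMonomialCoeff_eq_zero_of_lt Δ ℓ (by omega), zero_mul, zero_mul]
    rw [h1, h2, mul_zero]

/-- The shift `N = ℓ + n` turns `T` into the `z`-series terms:
`T(n+ℓ, j) = (A_{n,j}/λ_ℓ) 𝒫_{Δ+n,j}(x,y)` (`0 < xy`; on the descendant range `n+ℓ-j` is even and
`(Δ-ℓ)/2 + (n+ℓ-j)/2 = (Δ+n-j)/2`; off it both sides vanish). [cite: HogervorstRychkov2013, §3 eq. (3.5)] -/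
theorem hrZTermDeg_shift {Δ : ℝ} {ℓ : ℕ} {x y : ℝ} (hx : 0 < x) (hy : 0 < y) (n j : ℕ) :
    hrZTermDeg Δ ℓ x y (n + ℓ, j) = hrZTerm Δ ℓ x y (n, j) := by
  unfold hrZTermDeg hrZTerm zMono
  rw [if_pos (Nat.le_add_left ℓ n)]
  simp only [Nat.add_sub_cancel]
  by_cases hr : InDescendantRange ℓ n j
  · obtain ⟨_, hj, hpar⟩ := hr
    have hxy : 0 < x * y := mul_pos hx hy
    have ht : 2 * ((n + ℓ - j) / 2) = n + ℓ - j := by omega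
    have hj' : j ≤ n + ℓ := by omega
    have htR : (((n + ℓ - j) / 2 : ℕ) : ℝ) * 2 = (n : ℝ) + ℓ - j := by
      have h1 : (((2 * ((n + ℓ - j) / 2) : ℕ) : ℝ)) = ((n + ℓ - j : ℕ) : ℝ) := by rw [ht]
      rw [Nat.cast_sub hj'] at h1
      push_cast at h1
      linarith
    have hpow : (x * y) ^ ((Δ - (ℓ : ℝ)) / 2) * (x * y) ^ ((n + ℓ - j) / 2) =
        (x * y) ^ ((Δ + (n : ℝ) - (j : ℝ)) / 2) := by
      rw [← Real.rpow_natCast (x * y) ((n + ℓ - j) / 2), ← Real.rpow_add hxy]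
      congr 1
      linarith
    calc (x * y) ^ ((Δ - (ℓ : ℝ)) / 2) *
          (hrCoeff Δ ℓ n j / legendreLam ℓ * ((x * y) ^ ((n + ℓ - j) / 2) * zLegendre j x y))
        = hrCoeff Δ ℓ n j / legendreLam ℓ *
            ((x * y) ^ ((Δ - (ℓ : ℝ)) / 2) * (x * y) ^ ((n + ℓ - j) / 2) * zLegendre j x y) := by
          ring
      _ = _ := by rw [hpow]
  · rw [hrCoeff_eq_zero_of_not_inDescendantRange Δ hr, zero_div, zero_mul, zero_mul, mul_zero]

/-- Antidiagonal summation of a double power series at a real point of the square. [folklore] -/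
theorem IsDoublePowerSeriesOn.hasSum_antidiagonal {k : ℕ × ℕ → ℝ} {K : ℝ → ℝ → ℝ}
    (hS : IsDoublePowerSeriesOn k K) {x y : ℝ} (hx0 : 0 ≤ x) (hx1 : x < 1) (hy0 : 0 ≤ y)
    (hy1 : y < 1) :
    HasSum (fun N : ℕ => ∑ p ∈ antidiagonal N, k p * x ^ p.1 * y ^ p.2) (K x y) := by
  have h := hasSum_sum_antidiagonal_of_summable (hS.summable hx0 hx1 hy0 hy1)
  rwa [← hS.eq_tsum hx0 hx1 hy0 hy1] at h

/-- **The `z`-series of a genuine block at every real point of the square (T1, off-diagonal).**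
At a regular `(Δ, ℓ)` every `g` with `IsConformalBlock3D 0 0 Δ ℓ g` satisfies, for `0 < x, y < 1`,
`g(x,y) = Σ_{(n,j)} (A_{n,j}(Δ,ℓ)/λ_ℓ) 𝒫_{Δ+n,j}(x,y)` as a convergent double series of non-negative
terms (`hrZTerm_nonneg`). [cite: HogervorstRychkov2013, §3 eqs. (3.4), (3.9)] -/
theorem IsConformalBlock3D.hasSum_hrZTerm {Δ : ℝ} {ℓ : ℕ} {g : ℝ → ℝ → ℝ}
    (hΔ : unitarityBound3D ℓ < Δ) (hreg : ¬ accidentalDegeneracy3D Δ ℓ)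
    (h : IsConformalBlock3D 0 0 Δ ℓ g) {x y : ℝ} (hx : x ∈ Ioo (0 : ℝ) 1) (hy : y ∈ Ioo (0 : ℝ) 1) :
    HasSum (hrZTerm Δ ℓ x y) (g x y) := by
  have hregpt : IsRegularPoint3D Δ ℓ := ⟨ne_of_gt hΔ, hreg⟩
  obtain ⟨k, K, hS, hsym, hlead, hg, hC⟩ :=
    (isConformalBlock3D_iff_above_of_isRegularPoint3D hregpt).mp h
  have hk : SatisfiesCoeffCasimir 0 0 Δ ℓ k := by
    simpa using satisfiesCoeffCasimir_of_casimirEq3D hS hg hC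
  have hkeq : k = hrMonomialCoeff Δ ℓ := hk.eq_hrMonomialCoeff hΔ hreg hsym hlead
  -- antidiagonal sums of the double power series, times the prefactor
  have h1 := (hS.hasSum_antidiagonal hx.1.le hx.2 hy.1.le hy.2).mul_left
    ((x * y) ^ ((Δ - (ℓ : ℝ)) / 2))
  rw [← hg x y hx hy, hkeq] at h1
  -- rows of `T`
  have hfun : (fun N : ℕ => (x * y) ^ ((Δ - (ℓ : ℝ)) / 2) *
      ∑ p ∈ antidiagonal N, hrMonomialCoeff Δ ℓ p * x ^ p.1 * y ^ p.2) =
      fun N : ℕ => ∑ j ∈ range (N + 1), hrZTermDeg Δ ℓ x y (N, j) :=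
    funext fun N => (sum_range_hrZTermDeg Δ ℓ x y N).symm
  rw [hfun] at h1
  -- regroup over `ℕ × ℕ`
  have h2 : HasSum (hrZTermDeg Δ ℓ x y) (g x y) :=
    hasSum_prod_of_hasSum_rows (hrZTermDeg_nonneg hΔ hx.1.le hy.1.le)
      (fun N j hNj => hrZTermDeg_eq_zero_of_lt Δ ℓ x y hNj) h1
  -- shift `N = n + ℓ`
  have hinj : Function.Injective (fun q : ℕ × ℕ => (q.1 + ℓ, q.2)) := by
    intro a b hab
    simp only [Prod.mk.injEq, add_left_inj] at hab
    exact Prod.ext hab.1 hab.2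
  have hoff : ∀ q : ℕ × ℕ, q ∉ Set.range (fun q : ℕ × ℕ => (q.1 + ℓ, q.2)) →
      hrZTermDeg Δ ℓ x y q = 0 := by
    intro q hq
    have hlt : q.1 < ℓ := by
      by_contra hge
      rw [not_lt] at hge
      exact hq ⟨(q.1 - ℓ, q.2), Prod.ext (Nat.sub_add_cancel hge) rfl⟩
    unfold hrZTermDeg
    rw [if_neg (by omega)]
  have h3 := (hinj.hasSum_iff hoff).mpr h2
  have hfun' : (hrZTermDeg Δ ℓ x y ∘ fun q : ℕ × ℕ => (q.1 + ℓ, q.2)) = hrZTerm Δ ℓ x y :=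
    funext fun q => hrZTermDeg_shift hx.1 hy.1 q.1 q.2
  rw [hfun'] at h3
  exact h3

/-- The same as an equation: `g(x,y) = Σ' (A_{n,j}/λ_ℓ) 𝒫_{Δ+n,j}(x,y)`.
[cite: HogervorstRychkov2013, §3 eqs. (3.4), (3.9)] -/
theorem IsConformalBlock3D.eq_tsum_hrZTerm {Δ : ℝ} {ℓ : ℕ} {g : ℝ → ℝ → ℝ}
    (hΔ : unitarityBound3D ℓ < Δ) (hreg : ¬ accidentalDegeneracy3D Δ ℓ)
    (h : IsConformalBlock3D 0 0 Δ ℓ g) {x y : ℝ} (hx : x ∈ Ioo (0 : ℝ) 1) (hy : y ∈ Ioo (0 : ℝ) 1) :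
    g x y = ∑' q : ℕ × ℕ, hrZTerm Δ ℓ x y q :=
  (h.hasSum_hrZTerm hΔ hreg hx hy).tsum_eq.symm

/-- **Every finite partial sum is a lower bound** off the diagonal too (all terms non-negative).
[cite: HogervorstRychkov2013, §3 eq. (3.9)] -/
theorem IsConformalBlock3D.sum_hrZTerm_le {Δ : ℝ} {ℓ : ℕ} {g : ℝ → ℝ → ℝ}
    (hΔ : unitarityBound3D ℓ < Δ) (hreg : ¬ accidentalDegeneracy3D Δ ℓ)
    (h : IsConformalBlock3D 0 0 Δ ℓ g) {x y : ℝ} (hx : x ∈ Ioo (0 : ℝ) 1) (hy : y ∈ Ioo (0 : ℝ) 1)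
    (F : Finset (ℕ × ℕ)) : ∑ q ∈ F, hrZTerm Δ ℓ x y q ≤ g x y :=
  sum_le_hasSum F (fun q _ => hrZTerm_nonneg hΔ hx.1.le hy.1.le q) (h.hasSum_hrZTerm hΔ hreg hx hy)

/-- In particular a genuine block is non-negative at every real point of the square (regular
`(Δ, ℓ)`). [cite: HogervorstRychkov2013, §3 after eq. (3.9)] -/
theorem IsConformalBlock3D.nonneg_offdiag {Δ : ℝ} {ℓ : ℕ} {g : ℝ → ℝ → ℝ}
    (hΔ : unitarityBound3D ℓ < Δ) (hreg : ¬ accidentalDegeneracy3D Δ ℓ)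
    (h : IsConformalBlock3D 0 0 Δ ℓ g) {x y : ℝ} (hx : x ∈ Ioo (0 : ℝ) 1) (hy : y ∈ Ioo (0 : ℝ) 1) :
    0 ≤ g x y := by
  simpa using h.sum_hrZTerm_le hΔ hreg hx hy ∅

/-! ### Point functionals: block positivity from termwise positivity -/

/-- `F^{s}_{sign}` commutes with scalars. [folklore] -/
theorem crossF_const_mul (s sign c : ℝ) (G : ℝ → ℝ → ℝ) (z zb : ℝ) :
    crossF s sign (fun x y => c * G x y) z zb = c * crossF s sign G z zb := by
  unfold crossF
  ring

/-- If `Σ_i f_i = S` pointwise on the open square then `Σ_i F^{s}_{sign}[f_i] = F^{s}_{sign}[S]`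
pointwise on the open square (the reflected node `(1-z, 1-z̄)` stays in the square). [folklore] -/
theorem hasSum_crossF {ι : Type} {f : ι → ℝ → ℝ → ℝ} {S : ℝ → ℝ → ℝ} (s sign : ℝ)
    (h : ∀ z zb : ℝ, z ∈ Ioo (0 : ℝ) 1 → zb ∈ Ioo (0 : ℝ) 1 → HasSum (fun i => f i z zb) (S z zb))
    {z zb : ℝ} (hz : z ∈ Ioo (0 : ℝ) 1) (hzb : zb ∈ Ioo (0 : ℝ) 1) :
    HasSum (fun i => crossF s sign (f i) z zb) (crossF s sign S z zb) := by
  unfold crossF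
  have h1 := (h z zb hz hzb).mul_left (((1 - z) * (1 - zb)) ^ s)
  have h2 := (h (1 - z) (1 - zb) ⟨by linarith [hz.2], by linarith [hz.1]⟩
    ⟨by linarith [hzb.2], by linarith [hzb.1]⟩).mul_left (sign * (z * zb) ^ s)
  have h3 := h1.add h2
  have hfun : (fun i => ((1 - z) * (1 - zb)) ^ s * f i z zb + sign * (z * zb) ^ s * f i (1 - z) (1 - zb))
      = fun i => ((1 - z) * (1 - zb)) ^ s * f i z zb + sign * (z * zb) ^ s * f i (1 - z) (1 - zb) :=
    rfl
  exact h3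

/-- **Termwise action on the `z`-series.** For a point-evaluation functional `φ` with nodes in the open
square and a genuine block `g` at a regular `(Δ, ℓ)`:
`φ[F^{s}_{sign}[g]] = Σ_{(n,j)} (A_{n,j}/λ_ℓ) φ[F^{s}_{sign}[𝒫_{Δ+n,j}]]`.
[cite: HogervorstRychkov2013, §3 eqs. (3.4), (3.9)] -/
theorem hasSum_pointFunctional_crossF_hrZ {n : ℕ} (w z zb : Fin n → ℝ)
    (hz : ∀ k, z k ∈ Ioo (0 : ℝ) 1) (hzb : ∀ k, zb k ∈ Ioo (0 : ℝ) 1) (s sign : ℝ) {Δ : ℝ} {ℓ : ℕ}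
    {g : ℝ → ℝ → ℝ} (hΔ : unitarityBound3D ℓ < Δ) (hreg : ¬ accidentalDegeneracy3D Δ ℓ)
    (h : IsConformalBlock3D 0 0 Δ ℓ g) :
    HasSum (fun q : ℕ × ℕ => hrCoeff Δ ℓ q.1 q.2 / legendreLam ℓ *
        pointFunctional w z zb (crossF s sign (zMono (Δ + (q.1 : ℝ)) q.2)))
      (pointFunctional w z zb (crossF s sign g)) := by
  have hpt : ∀ x y : ℝ, x ∈ Ioo (0 : ℝ) 1 → y ∈ Ioo (0 : ℝ) 1 →
      HasSum (fun q : ℕ × ℕ => (fun x' y' => hrCoeff Δ ℓ q.1 q.2 / legendreLam ℓ *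
        zMono (Δ + (q.1 : ℝ)) q.2 x' y') x y) (g x y) :=
    fun x y hx hy => h.hasSum_hrZTerm hΔ hreg hx hy
  have hF := evaluationContinuous_pointFunctional w z zb hz hzb (ℕ × ℕ) _ _
    (fun x y hx hy => hasSum_crossF s sign hpt hx hy)
  have hfun : (fun q : ℕ × ℕ => pointFunctional w z zb (crossF s sign
      (fun x' y' => hrCoeff Δ ℓ q.1 q.2 / legendreLam ℓ * zMono (Δ + (q.1 : ℝ)) q.2 x' y'))) =
      fun q : ℕ × ℕ => hrCoeff Δ ℓ q.1 q.2 / legendreLam ℓ *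
        pointFunctional w z zb (crossF s sign (zMono (Δ + (q.1 : ℝ)) q.2)) := by
    funext q
    have hc : crossF s sign (fun x' y' => hrCoeff Δ ℓ q.1 q.2 / legendreLam ℓ *
        zMono (Δ + (q.1 : ℝ)) q.2 x' y') =
        fun x' y' => hrCoeff Δ ℓ q.1 q.2 / legendreLam ℓ * crossF s sign (zMono (Δ + (q.1 : ℝ)) q.2) x' y' :=
      funext fun x' => funext fun y' => crossF_const_mul s sign _ _ x' y'
    rw [hc]
    have hsm : (fun x' y' => hrCoeff Δ ℓ q.1 q.2 / legendreLam ℓ *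
        crossF s sign (zMono (Δ + (q.1 : ℝ)) q.2) x' y') =
        (hrCoeff Δ ℓ q.1 q.2 / legendreLam ℓ) • crossF s sign (zMono (Δ + (q.1 : ℝ)) q.2) := by
      funext x' y'
      simp only [Pi.smul_apply, smul_eq_mul]
    rw [hsm, map_smul, smul_eq_mul]
  rw [hfun] at hF
  exact hF

/-- **Block positivity from termwise positivity (finite head + non-negative tail).** Let `φ` be a
point-evaluation functional with nodes in the open square, `(Δ, ℓ)` regular, `F` a finite set of
indices. If `φ[F^{s}_{-}[𝒫_{Δ+n,j}]] ≥ 0` for every `(n, j) ∉ F` on the descendant range and the head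
`Σ_{(n,j) ∈ F} (A_{n,j}/λ_ℓ) φ[F^{s}_{-}[𝒫_{Δ+n,j}]] ≥ 0`, then `φ` is block-positive at `(Δ, ℓ)` for
external dimension `s`. (The rule of certificate verification by truncated `z`-series with a termwise
non-negative remainder.) [cite: HogervorstRychkov2013, §3 eq. (3.9)] -/
theorem blockPositive_pointFunctional_of_termwise {n : ℕ} (w z zb : Fin n → ℝ)
    (hz : ∀ k, z k ∈ Ioo (0 : ℝ) 1) (hzb : ∀ k, zb k ∈ Ioo (0 : ℝ) 1) {s Δ : ℝ} {ℓ : ℕ}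
    (hΔ : unitarityBound3D ℓ < Δ) (hreg : ¬ accidentalDegeneracy3D Δ ℓ) (F : Finset (ℕ × ℕ))
    (hhead : 0 ≤ ∑ q ∈ F, hrCoeff Δ ℓ q.1 q.2 / legendreLam ℓ *
      pointFunctional w z zb (crossF s (-1) (zMono (Δ + (q.1 : ℝ)) q.2)))
    (htail : ∀ q : ℕ × ℕ, q ∉ F → InDescendantRange ℓ q.1 q.2 →
      0 ≤ pointFunctional w z zb (crossF s (-1) (zMono (Δ + (q.1 : ℝ)) q.2))) :
    BlockPositive (pointFunctional w z zb) s Δ ℓ := by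
  intro g hg
  have hS := hasSum_pointFunctional_crossF_hrZ w z zb hz hzb s (-1) hΔ hreg hg
  refine hhead.trans (sum_le_hasSum F (fun q hq => ?_) hS)
  by_cases hr : InDescendantRange ℓ q.1 q.2
  · exact mul_nonneg (div_nonneg (hrCoeff_nonneg hΔ _ _) (legendreLam_pos ℓ).le) (htail q hq hr)
  · rw [hrCoeff_eq_zero_of_not_inDescendantRange Δ hr, zero_div, zero_mul]

/-- **Fully termwise form** (`F = ∅`): if `φ[F^{s}_{-}[𝒫_{Δ+n,j}]] ≥ 0` for every `(n, j)` on the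
descendant range then `φ` is block-positive at the regular point `(Δ, ℓ)`.
[cite: HogervorstRychkov2013, §3 eq. (3.9)] -/
theorem blockPositive_pointFunctional_of_forall {n : ℕ} (w z zb : Fin n → ℝ)
    (hz : ∀ k, z k ∈ Ioo (0 : ℝ) 1) (hzb : ∀ k, zb k ∈ Ioo (0 : ℝ) 1) {s Δ : ℝ} {ℓ : ℕ}
    (hΔ : unitarityBound3D ℓ < Δ) (hreg : ¬ accidentalDegeneracy3D Δ ℓ)
    (hterm : ∀ q : ℕ × ℕ, InDescendantRange ℓ q.1 q.2 →
      0 ≤ pointFunctional w z zb (crossF s (-1) (zMono (Δ + (q.1 : ℝ)) q.2))) :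
    BlockPositive (pointFunctional w z zb) s Δ ℓ :=
  blockPositive_pointFunctional_of_termwise w z zb hz hzb hΔ hreg ∅ (by simp)
    (fun q _ hr => hterm q hr)

end Literature.MathematicalPhysics.QuantumFieldTheory.ConformalBootstrap3D
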